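import Literature.Probability.Percolation.SlabBoxCrossingProperty
import Literature.Probability.Percolation.SlabBoxCrossingPropertyBlocking
import HarnessLib

/-!
# Newman–Tassion–Wu 2017, Corollary 3.2 (ii)–(iii) from the box-crossing property, and from
# Theorem 3.1 (named fact) at `p_c(S_k)`

Topic: `Literature/Probability/Percolation`. NTW's Corollary 3.2 ("For critical Bernoulli
percolation on the slab `S_k`, we have: … (ii) [blocking surfaces] there exists `c > 0` such that
for every `n ≥ 1`, `P_p[∃ open path from B̄_n to ∂B̄_{2n}] ≤ 1 - c`; (iii) [polynomial decay of the
1-arm event] there exists `δ > 0` such that for `n > m ≥ 1`, `P_p[∃ open path from B̄_m to ∂B̄_n]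
≤ (m/n)^δ`", arXiv:1512.09107 p. 7), derived:

* API of the statement file: `crossingProb_nonneg`, `crossingProb_le_one`,
  `BoxCrossingProperty.lower/upper/nat` (integer aspect ratios);
* from the box-crossing property at ANY parameter — `BoxCrossingProperty.oneArm_two_le`
  (item (ii)), `BoxCrossingProperty.oneArm_decay` (item (iii), in the explicit form
  `≤ C · ((m+1)/(n+1))^δ`), using only the UPPER bound at aspect ratio 4
  (`SlabBoxCrossingPropertyBlocking.lean`, `…Annuli.lean`);
* at `p_c(S_k)`, `k ≥ 1`, from the named fact `NewmanTassionWu2017_thm31` —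
  `NewmanTassionWu2017.cor32_ii`, `NewmanTassionWu2017.cor32_iii` (CONDITIONAL on the named fact
  until `NewmanTassionWu2017_thm31_holds` lands).

Events: `slabConn k (sqBox 0 N) (sqBox 0 m) (sqSphere 0 N)` = "an open path of `S_k` inside `B̄_N`
from `B̄_m` to `∂B̄_N`" (DST/NTW notation; `SlabCriticality.lean`).  Item (i) of Cor. 3.2 (open
circuits, via NTW's Thm. 3.10) is not treated.

## Sources

* C. M. Newman, V. Tassion, W. Wu, *Critical percolation and the minimal spanning tree in slabs*,
  Comm. Pure Appl. Math. 70 (2017) 2084–2120, arXiv:1512.09107: Corollary 3.2 and §3.8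
  [NewmanTassionWu2017].
-/

noncomputable section

namespace Literature.Probability.Percolation

open MeasureTheory LatticeModels

namespace NTW17

/-- `0 ≤ f_p(m,n)`. [cite: NewmanTassionWu2017, §3 (3.1)] -/
theorem crossingProb_nonneg (k : ℕ) (p : unitInterval) (m n : ℕ) : 0 ≤ crossingProb k p m n :=
  measureReal_nonneg

/-- `f_p(m,n) ≤ 1`. [cite: NewmanTassionWu2017, §3 (3.1)] -/
theorem crossingProb_le_one (k : ℕ) (p : unitInterval) (m n : ℕ) : crossingProb k p m n ≤ 1 :=
  measureReal_le_one

/-- The lower half of the box-crossing property at a given aspect ratio.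
[cite: NewmanTassionWu2017, Theorem 3.1 ((3.2))] -/
theorem BoxCrossingProperty.lower {k : ℕ} {p : unitInterval} (h : BoxCrossingProperty k p)
    {ρ : ℝ} (hρ : 0 < ρ) :
    ∃ c : ℝ, 0 < c ∧ ∀ n : ℕ, 1 ≤ ρ * n → c ≤ crossingProb k p n ⌊ρ * n⌋₊ := by
  obtain ⟨c, hc, h⟩ := h ρ hρ
  exact ⟨c, hc, fun n hn => (h n hn).1⟩

/-- The upper half of the box-crossing property at a given aspect ratio.
[cite: NewmanTassionWu2017, Theorem 3.1 ((3.2))] -/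
theorem BoxCrossingProperty.upper {k : ℕ} {p : unitInterval} (h : BoxCrossingProperty k p)
    {ρ : ℝ} (hρ : 0 < ρ) :
    ∃ c : ℝ, 0 < c ∧ ∀ n : ℕ, 1 ≤ ρ * n → crossingProb k p n ⌊ρ * n⌋₊ ≤ 1 - c := by
  obtain ⟨c, hc, h⟩ := h ρ hρ
  exact ⟨c, hc, fun n hn => (h n hn).2⟩

/-- At an INTEGER aspect ratio `r ≥ 1` the property reads: `∃ c > 0, ∀ n ≥ 1, c ≤ f(n, rn) ≤ 1 - c`.
[cite: NewmanTassionWu2017, Theorem 3.1 ((3.2))] -/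
theorem BoxCrossingProperty.nat {k : ℕ} {p : unitInterval} (h : BoxCrossingProperty k p)
    {r : ℕ} (hr : 1 ≤ r) :
    ∃ c : ℝ, 0 < c ∧ ∀ n : ℕ, 1 ≤ n →
      c ≤ crossingProb k p n (r * n) ∧ crossingProb k p n (r * n) ≤ 1 - c := by
  obtain ⟨c, hc, h⟩ := h r (by exact_mod_cast hr)
  refine ⟨c, hc, fun n hn => ?_⟩
  have hfloor : ⌊(r : ℝ) * n⌋₊ = r * n := by
    rw [show (r : ℝ) * n = ((r * n : ℕ) : ℝ) by push_cast; ring, Nat.floor_natCast]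
  have h1 : (1 : ℝ) ≤ (r : ℝ) * n := by
    have : (1 : ℝ) ≤ ((r * n : ℕ) : ℝ) := by exact_mod_cast Nat.one_le_iff_ne_zero.2 (by positivity)
    push_cast at this; exact this
  have := h n h1
  rwa [hfloor] at this

variable {k : ℕ} {p : unitInterval}

/-- **Cor. 3.2 (ii) from the box-crossing property** (any `p`): there is `c > 0` with
`P_p[B̄_n ⟷^{B̄_{2n}} ∂B̄_{2n}] ≤ 1 - c` for every `n ≥ 1` — from `f_p(n,4n) ≤ 1 - c₄` and
`real_oneArm_two_le_of_lr_le` (`c = c₄⁴`). [cite: NewmanTassionWu2017, Corollary 3.2 (ii) and §3.8] -/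
theorem BoxCrossingProperty.oneArm_two_le (h : BoxCrossingProperty k p) :
    ∃ c : ℝ, 0 < c ∧ ∀ n : ℕ, 1 ≤ n →
      (bondPercolation (slabGraph 3 k) p).real (slabConn k (sqBox 0 (2 * n)) (sqBox 0 n) (sqSphere 0 (2 * n))) ≤
        1 - c := by
  obtain ⟨c, hc, h4⟩ := h.nat (r := 4) (by norm_num)
  refine ⟨c ^ 4, by positivity, fun n hn => ?_⟩
  have h1 := (h4 n hn).2
  rw [crossingProb_eq] at h1
  exact real_oneArm_two_le_of_lr_le n hc.le p (by exact_mod_cast h1)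

/-- **Cor. 3.2 (iii) from the box-crossing property** (any `p`, explicit form): there are `C > 0`
and `δ > 0` with `P_p[B̄_m ⟷^{B̄_n} ∂B̄_n] ≤ C · ((m+1)/(n+1))^δ` for all `1 ≤ m ≤ n`
(`C = (1 - c₄⁴)⁻¹`, `δ = -log(1 - c₄⁴)/log 2`). [cite: NewmanTassionWu2017, Corollary 3.2 (iii) and §3.8] -/
theorem BoxCrossingProperty.oneArm_decay (h : BoxCrossingProperty k p) :
    ∃ C δ : ℝ, 0 < C ∧ 0 < δ ∧ ∀ m n : ℕ, 1 ≤ m → m ≤ n →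
      (bondPercolation (slabGraph 3 k) p).real (slabConn k (sqBox 0 n) (sqBox 0 m) (sqSphere 0 n)) ≤
        C * (((m : ℝ) + 1) / ((n : ℝ) + 1)) ^ δ := by
  obtain ⟨c, hc, h4⟩ := h.nat (r := 4) (by norm_num)
  -- shrink `c` below `1`
  set c' : ℝ := min c (1 / 2) with hc'
  have hc'0 : 0 < c' := lt_min hc (by norm_num)
  have hc'1 : c' < 1 := lt_of_le_of_lt (min_le_right _ _) (by norm_num)
  have hc'c : c' ≤ c := min_le_left _ _
  have h4' : ∀ n : ℕ, 1 ≤ n → (bondPercolation (slabGraph 3 k) p).real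
      (slabConn k (boxR 0 n 0 (4 * n)) {z | z.1 = 0} {z | z.1 = n}) ≤ 1 - c' := by
    intro n hn
    have h1 := (h4 n hn).2
    rw [crossingProb_eq] at h1
    push_cast at h1
    linarith
  have h14 : 0 < 1 - c' ^ 4 := by
    have : c' ^ 4 < 1 ^ 4 := by gcongr
    linarith [this, show (1 : ℝ) ^ 4 = 1 by norm_num]
  refine ⟨(1 - c' ^ 4)⁻¹, -Real.log (1 - c' ^ 4) / Real.log 2, by positivity, ?_, fun m n hm hmn =>
    real_oneArm_le_rpow_of_lr_le_pos hc'0 hc'1 p h4' hm hmn⟩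
  have hc4 : 0 < c' ^ 4 := by positivity
  exact div_pos (neg_pos.2 (Real.log_neg h14 (by linarith))) (Real.log_pos one_lt_two)

end NTW17

/-- **NTW 2017, Corollary 3.2 (ii) at `p_c(S_k)`** (blocking closed surfaces in `A_{n,2n}` with
probability `≥ c`), CONDITIONAL on the named fact `NewmanTassionWu2017_thm31`: for every `k ≥ 1`
there is `c > 0` with `P_{p_c(S_k)}[B̄_n ⟷^{B̄_{2n}} ∂B̄_{2n}] ≤ 1 - c` for all `n ≥ 1`.
[cite: NewmanTassionWu2017, Corollary 3.2 (ii)] -/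
theorem NewmanTassionWu2017.cor32_ii (h : NewmanTassionWu2017_thm31) {k : ℕ} (hk : 1 ≤ k) :
    ∃ c : ℝ, 0 < c ∧ ∀ n : ℕ, 1 ≤ n →
      (bondPercolation (slabGraph 3 k) (criticalProbIOf (slabGraph 3 k) (slabOrigin 3 k))).real
        (slabConn k (sqBox 0 (2 * n)) (sqBox 0 n) (sqSphere 0 (2 * n))) ≤ 1 - c :=
  (h k hk).oneArm_two_le

/-- **NTW 2017, Corollary 3.2 (iii) at `p_c(S_k)`** (polynomial decay of the one-arm probability:
"strengthens the previous result of [DST]"), CONDITIONAL on the named fact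
`NewmanTassionWu2017_thm31`: for every `k ≥ 1` there are `C, δ > 0` with
`P_{p_c(S_k)}[B̄_m ⟷^{B̄_n} ∂B̄_n] ≤ C ((m+1)/(n+1))^δ` for all `1 ≤ m ≤ n`.
[cite: NewmanTassionWu2017, Corollary 3.2 (iii)] -/
theorem NewmanTassionWu2017.cor32_iii (h : NewmanTassionWu2017_thm31) {k : ℕ} (hk : 1 ≤ k) :
    ∃ C δ : ℝ, 0 < C ∧ 0 < δ ∧ ∀ m n : ℕ, 1 ≤ m → m ≤ n →
      (bondPercolation (slabGraph 3 k) (criticalProbIOf (slabGraph 3 k) (slabOrigin 3 k))).real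
        (slabConn k (sqBox 0 n) (sqBox 0 m) (sqSphere 0 n)) ≤ C * (((m : ℝ) + 1) / ((n : ℝ) + 1)) ^ δ :=
  (h k hk).oneArm_decay

end Literature.Probability.Percolation
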